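import Summits.QuantumFields.BalabanUV.Beta.EriceRemainderEnclosureHistoryAutonomyComparisonAgeCompositionJointPolytope

/-!
# EriceRemainderEnclosureHistoryAutonomyComparisonAgeCompositionNestedTwoPairs — (E93b) route (N), first order: THE NESTED STEPS WITH BOTH PAIR SHARE BOUNDS
# KEPT — THE CENSUS THREE AGES FROM A FLATTENED PIECEWISE CERTIFICATE.  (E92d) kept the young pair's bound `x₁ + x₂ ≤ σ₁`, (E92f) the old pair's
# `x₂ + x₃ ≤ σ₂`; here ALL THREE actual loads are kept through both residual steps, `ε ≥ Φ(x₁,x₂,x₃)·e` with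
# `Φ = (1−x₁)((1−x₂)(1−x₃) − E x₂x₃) − Bx₁x₂ − Cx₁x₃` (`E = 2(k₂+1)∕k₃`, `B = 4∕k₂`, `C = 4∕k₃`), and (E93a) `joint_polytope_nonneg` turns `Φ ≥ 0` on the
# polytope `{xᵢ ≤ √2∕2, x₁+x₂ ≤ σ₁, x₂+x₃ ≤ σ₂}` into a finite list of DISPLAYED inequalities (certificate data `b₁, a₂, ρ₁…ρ₄`).  Numerically the
# certificate holds for EVERY `k₃ ≥ 57` when `18 ≤ k₂ ≤ 45` (README g83∕e92 §5(1)); the rational bands that would type this are successor work (≈ 60 band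
# instances by monotonicity: `Φ` is non-increasing in `E, B, C` and the polytope grows with `σ₁, σ₂`)

Cell `pub-balaban`, β-function sub-cell, BINDER row D4 «RemainderConst leaves for Bałaban's split» (`HOME/BINDER-OWNERS.md`; owner lineage `b2b-balaban-beta-an4`;
this file by co-owner #2 lineage `b2b-balaban-beta-d4-p2`, generation 83), β-FLOW TEAM duty (1), FREEZE (0) honoured (def-free; nothing restated).

HONEST FRAMING (page 1, verbatim and binding).  *"Discharging BetaPertH makes Bałaban's UV stability UNCONDITIONAL — a real constructive-QFT result; it is
NOT the continuum limit and NOT the Clay problem."*  THIS FILE DISCHARGES NOTHING OF THE KIND.  Elementary real algebra ∕ real analysis about ABSTRACT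
functionals on a box ]0,γ]^ℕ with displayed floors, profiles and signs, and the FIRST-ORDER renewal objects of route (N) built from them — hypotheses of a
census, not facts; the form, signs, ages and moments of Bałaban's (1.22) limit functional are NOT PRINTED ([I] p. 298; GAPS G-t4-U2-1∕-2) and NOT asserted.
Row D4 class UNCHANGED (critical-path width 0; instance 0∕1; D4 DISCHARGE NO DATE).  HONEST DEPENDENCY: continuum YM on T⁴ ⇐ BetaPertH ∧ nine spine
estimates (0/9 proved); BetaPertH ⇐ (D1) ∧ (D4) ∧ CAP+tail; G-an2-4 gates asym, D1 and NE2/3/4.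

THE POINT.  Middle step ((E92c) `residual_step_moment`, `sy = x₂`, the actual `x₃` kept as in (E92f)): `e − O − M ≥ R₂·e`, `R₂ = (1−x₂)(1−x₃) − E x₂x₃`;
young step (`sy = x₁` actual, first moment `c₁ = x₁` as in (E92d)): `ε ≥ [(1−x₁)R₂ − 4x₁(c₂ + c₃)]·e = Φ·e`; both pair bounds from (E92b)
`pair_load_le_of_ratio` (`p₁⁴(k₂+1) ≤ 2`, `p₂⁴(k₃+1) ≤ k₂+1`); `Φ ≥ 0` and `R₂ ≥ 0` from (E93a) `joint_polytope_nonneg_guarded`.  The abbreviations `s, σ₁, σ₂, E, B, C` enter as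
explicit parameters with defining equations so that the certificate hypotheses are short.  Uses (E93a) `joint_polytope_nonneg_guarded`, (E92c)
`residual_step_moment`∕`row_moment_le`, (E92b) `pair_load_le_of_ratio`, (E92a) `renewal_bounds_of_step`, (E91a) `old_read_variation`, (E82a)
`kernel_entry_le`∕`row_mass_le`, (E89b) `window_load_le_sqrt_two_div_two`, (E80b) `aggregate_eq_sum` BY NAME.  NOT CLAIMED: any rational instance (successor
work); `k₃ < 2(k₂+1)`; anything printed — NOT B12 Thm 2, NOT BetaPertH.

WHAT IS PROVED ([folklore]; 0 `def`, 0 sorry).  **`flow_nonneg_census_three_ages_two_pairs`**.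
-/
noncomputable section
open Finset

namespace Summit.QuantumFields.BalabanUV.Beta.EriceRemainderEnclosureHistoryAutonomyComparisonAgeCompositionNestedTwoPairs

open Literature.MathematicalPhysics.QuantumFieldTheory.Balaban1983to89
open Literature.MathematicalPhysics.QuantumFieldTheory.Balaban1983to89.T4BetaStationary
open Literature.MathematicalPhysics.QuantumFieldTheory.Balaban1983to89.T4BetaFlowWellPosed
open Summit.QuantumFields.BalabanUV.Beta.EriceRemainderEnclosureHistoryAutonomyComparisonAgeCompositionTwoAgesOldRead (old_read_variation)
open Summit.QuantumFields.BalabanUV.Beta.EriceRemainderEnclosureHistoryAutonomyComparisonAgeCompositionThreeAgesMassCap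
  (window_load_le_sqrt_two_div_two)
open Summit.QuantumFields.BalabanUV.Beta.EriceRemainderEnclosureHistoryAutonomyComparisonAgeCompositionYoungestTailSumFlow
  (kernel_entry_le row_mass_le)
open Summit.QuantumFields.BalabanUV.Beta.EriceRemainderEnclosureHistoryAutonomyComparisonAgeCompositionChainWiring (aggregate_eq_sum)
open Summit.QuantumFields.BalabanUV.Beta.EriceRemainderEnclosureHistoryAutonomyComparisonAgeCompositionNestedReads (renewal_bounds_of_step)
open Summit.QuantumFields.BalabanUV.Beta.EriceRemainderEnclosureHistoryAutonomyComparisonAgeCompositionPairShares (pair_load_le_of_ratio)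
open Summit.QuantumFields.BalabanUV.Beta.EriceRemainderEnclosureHistoryAutonomyComparisonAgeCompositionNestedMoments
  (residual_step_moment row_moment_le)
open Summit.QuantumFields.BalabanUV.Beta.EriceRemainderEnclosureHistoryAutonomyComparisonAgeCompositionJointPolytope (joint_polytope_nonneg_guarded)

variable {B : (ℕ → ℝ) → ℝ} {γ b gIR : ℝ} {L : ℕ → ℝ} {K : ℕ} {h g : ℕ → ℝ}

/-- **THE CENSUS THREE AGES `{1, k₂, k₃}` FROM THE JOINT TWO-PAIR CERTIFICATE.**  Profile carried by `{1, k₂, k₃}`, `2 ≤ k₂`, `2(k₂+1) ≤ k₃ < K`;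
dampings of the self-consistent class `g_t(1+F_t) ≥ 1`; `p₁, p₂ ≥ 0` with `p₁⁴(k₂+1) ≤ 2`, `p₂⁴(k₃+1) ≤ k₂+1`; abbreviations `s = √2∕2` (or any `s ∈ [√2∕2, 1]`), `σ₁ = √2∕(1+p₁)`,
`σ₂ = √2∕(1+p₂)`, `E = 2(k₂+1)∕k₃ ≤ 1`, `Bc = 4∕k₂`, `Cc = 4∕k₃` — or ANY UPPER BOUNDS of these (`σ₁, σ₂, E, Bc, Cc` are parameters bounded from below by
the actual values: `Φ` is non-increasing in `E, Bc, Cc` and the polytope grows with `σ₁, σ₂`, so one certificate serves a whole band of `(k₂, k₃)`);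
certificate data `b₁, a₂, ρ₁, ρ₂, ρ₃, ρ₄` satisfying the displayed inequalities of (E93a) `joint_polytope_nonneg_guarded` (the data of an empty regime are not asked for).  Then `0 ≤ ε ≤ e` at every pin for every
admissible excess and every horizon. [folklore] -/
theorem flow_nonneg_census_three_ages_two_pairs (hmono : ∀ u v : ℕ → ℝ, SeqBox γ u → SeqBox γ v → (∀ j, u j ≤ v j) → B u ≤ B v)
    (hL : ∀ k, 0 ≤ L k) (hb : 0 < b) (hlo : ∀ u, SeqBox γ u → b ≤ B u) (hdom : ∀ u, SeqBox γ u → ∑ k ∈ range K, L k * u k ≤ B u)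
    (hh : SeqBox γ h) (hf : MemFlow B gIR h) (hg : ∀ t, 0 < g t ∧ g t ≤ 1)
    (hgF : ∀ t, 1 ≤ g t * (1 + ∑ k ∈ range K, L k * h (t + k) ^ 3 / 2))
    {k₂ k₃ : ℕ} (hk2 : 2 ≤ k₂) (hk23 : 2 * (k₂ + 1) ≤ k₃) (hk3K : k₃ < K) (hL3 : ∀ j, j < K → j ≠ 1 → j ≠ k₂ → j ≠ k₃ → L j = 0)
    {p₁ p₂ : ℝ} (hp10 : 0 ≤ p₁) (hp1 : p₁ ^ 4 * ((k₂ : ℝ) + 1) ≤ 2) (hp20 : 0 ≤ p₂) (hp2 : p₂ ^ 4 * ((k₃ : ℝ) + 1) ≤ (k₂ : ℝ) + 1)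
    {s σ₁ σ₂ E Bc Cc : ℝ} (hs : Real.sqrt 2 / 2 ≤ s) (hs1 : s ≤ 1) (hσ1 : Real.sqrt 2 / (1 + p₁) ≤ σ₁) (hσ2 : Real.sqrt 2 / (1 + p₂) ≤ σ₂)
    (hE : 2 * ((k₂ : ℝ) + 1) / k₃ ≤ E) (hE1 : E ≤ 1) (hBc : 4 / (k₂ : ℝ) ≤ Bc) (hCc : 4 / (k₃ : ℝ) ≤ Cc) (hCB : Cc ≤ Bc)
    {b₁ a₂ ρ₁ ρ₂ ρ₃ ρ₄ : ℝ}
    (hb1 : σ₁ - s ≤ b₁ ∨ σ₂ - s ≤ b₁)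
    (hρ1 : ρ₁ ≤ (1 - s) - b₁ * ((1 - s) + E * s)) (c1ρ : 0 ≤ ρ₁)
    (cert1 : 0 ≤ (1 - s) * ρ₁ - s * (Bc * b₁ + Cc * s))
    (hρ2 : σ₁ < σ₂ → ρ₂ ≤ (1 - s) - (σ₂ - s) * ((1 - s) + E * s)) (c2ρ : σ₁ < σ₂ → 0 ≤ ρ₂)
    (cert2a : σ₁ < σ₂ → 0 ≤ (1 - σ₁ + (σ₁ - s)) * ρ₂ - (σ₁ - (σ₁ - s)) * (Bc * (σ₁ - s) + Cc * s))
    (cert2b : σ₁ < σ₂ → 0 ≤ (1 - σ₁ + (σ₁ - s)) * ρ₂ - (σ₁ - (σ₁ - s)) * (Bc * (σ₁ - s) + Cc * s)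
        + (ρ₂ + (Bc * (σ₁ - s) + Cc * s) - (σ₁ - (σ₁ - s)) * Bc) * ((σ₂ - s) - (σ₁ - s)))
    (hρ3a : σ₂ < σ₁ → ρ₃ ≤ (1 - σ₂) + (1 - E) * (σ₂ - s) * (σ₂ - (σ₂ - s)))
    (hρ3b : σ₂ < σ₁ → ρ₃ ≤ (1 - σ₂) + (1 - E) * (σ₁ - s) * (σ₂ - (σ₁ - s))) (c3ρ : σ₂ < σ₁ → 0 ≤ ρ₃)
    (cert3 : σ₂ < σ₁ → 0 ≤ (1 - s) * ρ₃ - s * (Bc * (σ₁ - s) + Cc * (σ₂ - (σ₁ - s))))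
    (ha2 : a₂ ≤ σ₁ - s ∨ a₂ ≤ σ₂ - s)
    (hρ4a : ρ₄ ≤ (1 - σ₂) + (1 - E) * a₂ * (σ₂ - a₂)) (hρ4b : ρ₄ ≤ (1 - σ₂) + (1 - E) * s * (σ₂ - s)) (c4ρ : 0 ≤ ρ₄)
    (cert4a : 0 ≤ (1 - σ₁ + a₂) * ρ₄ - (σ₁ - a₂) * (Bc * a₂ + Cc * (σ₂ - a₂)))
    (cert4b : 0 ≤ (1 - σ₁ + a₂) * ρ₄ - (σ₁ - a₂) * (Bc * a₂ + Cc * (σ₂ - a₂))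
        + (ρ₄ + (Bc * a₂ + Cc * (σ₂ - a₂)) - (σ₁ - a₂) * (Bc - Cc)) * (s - a₂))
    {N : ℕ} {KL : ℕ → ℕ → ℕ → ℝ}
    (hKL : ∀ k n l, KL k n l = if 0 < k ∧ k < K ∧ l < k then L k * h (n + k) ^ 3 / 2 * ∏ t ∈ Ico (n + 1 + l) (n + k + 1), g t else 0)
    {KA : ℕ → ℕ → ℕ → ℝ} {RA : ℕ → (ℕ → ℝ) → ℕ → ℝ}
    (hRA : ∀ i v m, RA i v m = ∑ l ∈ range K, KA i m l * v (m + 1 + l))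
    (hKA : ∀ i m l, KA i m l = KL i m l + KA (i + 1) m l) (hKAtop : ∀ m l, KA K m l = 0)
    {e ε : ℕ → ℝ} (he0 : ∀ m, 0 ≤ e m) (hea : ∀ m, e (m + 1) ≤ e m)
    (hεt : ∀ m, N < m → ε m = 0) (hεrec : ∀ m, ε m = e m - RA 1 ε m) : ∀ m, 0 ≤ ε m ∧ ε m ≤ e m := by
  have hpos : ∀ n, 0 < h n := fun n => (hh n).1
  have h1K : 1 < K := by omega
  have hk2K : k₂ < K := by omega
  have hj : 0 < k₂ := by omega
  have hk : 0 < k₃ := by omega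
  have hK : 1 ≤ K := by omega
  have hL0 : L 0 = 0 := hL3 0 (by omega) (by omega) (by omega) (by omega)
  have hs0r : 0 ≤ Real.sqrt 2 := Real.sqrt_nonneg 2
  have hs17 : Real.sqrt 2 ≤ 17 / 12 := Real.sqrt_le_iff.mpr ⟨by norm_num, by norm_num⟩
  have hjr : (0 : ℝ) < k₂ := by exact_mod_cast hj
  have hkr : (0 : ℝ) < k₃ := by exact_mod_cast hk
  have hk2ne : (k₂ : ℝ) ≠ 0 := hjr.ne'
  have hk3ne : (k₃ : ℝ) ≠ 0 := hkr.ne'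
  have hk23r : 2 * ((k₂ : ℝ) + 1) ≤ k₃ := by exact_mod_cast hk23
  have hea' : ∀ p q, p ≤ q → e q ≤ e p := by
    intro p q hpq
    induction q, hpq using Nat.le_induction with
    | base => exact le_rfl
    | succ q _ ih => exact (hea q).trans ih
  -- the abbreviations' elementary facts
  have hs0 : 0 ≤ s := le_trans (by positivity) hs
  have hE0 : 0 ≤ E := le_trans (by positivity) hE
  have hC0 : 0 ≤ Cc := le_trans (by positivity) hCc
  have hB0 : 0 ≤ Bc := hC0.trans hCB
  -- the aggregate row is the young row plus the middle row plus the old row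
  have hKA1 : ∀ m l, KA 1 m l = KL 1 m l + (KL k₂ m l + KL k₃ m l) := by
    intro m l
    have h1 : KA 1 m l = ∑ k' ∈ Ico 1 (K - 1 + 1), KL k' m l :=
      aggregate_eq_sum (n := K - 1) hKA (fun m l => by rw [Nat.sub_add_cancel hK]; exact hKAtop m l) (show 1 ≤ K - 1 + 1 by omega) m l
    rw [h1, Nat.sub_add_cancel hK]
    have hsub : ({1, k₂, k₃} : Finset ℕ) ⊆ Ico 1 K := by
      intro x hx
      simp only [mem_insert, mem_singleton] at hx
      rw [mem_Ico]; rcases hx with rfl | rfl | rfl <;> omega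
    rw [← sum_subset hsub (fun x hx hxn => by
      simp only [mem_insert, mem_singleton, not_or] at hxn
      rw [hKL]
      split_ifs
      · rw [hL3 x (mem_Ico.mp hx).2 hxn.1 hxn.2.1 hxn.2.2]; simp
      · rfl), sum_insert (by simp only [mem_insert, mem_singleton]; omega), sum_pair (by omega)]
  have hrec3 : ∀ p, ε p = e p - ∑ l ∈ range K, KL 1 p l * ε (p + 1 + l)
      - (∑ l ∈ range K, KL k₂ p l * ε (p + 1 + l) + ∑ l ∈ range K, KL k₃ p l * ε (p + 1 + l)) := by
    intro p
    rw [hεrec p, hRA]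
    have : ∑ l ∈ range K, KA 1 p l * ε (p + 1 + l) = ∑ l ∈ range K, KL 1 p l * ε (p + 1 + l)
        + (∑ l ∈ range K, KL k₂ p l * ε (p + 1 + l) + ∑ l ∈ range K, KL k₃ p l * ε (p + 1 + l)) := by
      rw [← sum_add_distrib, ← sum_add_distrib]; exact sum_congr rfl fun l _ => by rw [hKA1]; ring
    rw [this]; ring
  refine renewal_bounds_of_step he0 hεt fun m IH => ?_
  have hread0 : ∀ a p, m ≤ p → 0 ≤ ∑ l ∈ range K, KL a p l * ε (p + 1 + l) := fun a p hp =>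
    sum_nonneg fun l _ => mul_nonneg (kernel_entry_le hL hh hg hKL a p l).1 (IH _ (by omega)).1
  have hreadle : ∀ {a : ℕ}, a < K → ∑ l ∈ range K, KL a m l * ε (m + 1 + l) ≤ (a : ℝ) * (L a * h (m + a) ^ 3 / 2) * e m := by
    intro a haK
    calc ∑ l ∈ range K, KL a m l * ε (m + 1 + l) ≤ ∑ l ∈ range K, KL a m l * e m :=
          sum_le_sum fun l _ => mul_le_mul_of_nonneg_left
            (((IH _ (by omega)).2).trans (hea' m (m + 1 + l) (by omega))) (kernel_entry_le hL hh hg hKL a m l).1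
      _ = (∑ l ∈ range K, KL a m l) * e m := by rw [sum_mul]
      _ ≤ (a : ℝ) * (L a * h (m + a) ^ 3 / 2) * e m := mul_le_mul_of_nonneg_right (row_mass_le hL hh hg hKL haK m) (he0 m)
  -- the three loads at the pin and BOTH pair share bounds
  have hx1' := window_load_le_sqrt_two_div_two hmono hL hb hlo hdom hh hf h1K m
  have hx2 := window_load_le_sqrt_two_div_two hmono hL hb hlo hdom hh hf hk2K m
  have hx3 := window_load_le_sqrt_two_div_two hmono hL hb hlo hdom hh hf hk3K m
  have hpair1' := pair_load_le_of_ratio hmono hL hb hlo hdom hh hf le_rfl (show 1 < k₂ by omega) hk2K hp10 (by push_cast; linarith) m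
  have hpair2' := pair_load_le_of_ratio hmono hL hb hlo hdom hh hf (show 1 ≤ k₂ by omega) (show k₂ < k₃ by omega) hk3K hp20 hp2 m
  set c1 := L 1 * h (m + 1) ^ 3 / 2 with hc1_def
  set c2 := L k₂ * h (m + k₂) ^ 3 / 2 with hc2_def
  set c3 := L k₃ * h (m + k₃) ^ 3 / 2 with hc3_def
  have hc10 : 0 ≤ c1 := by have := hL 1; have := hpos (m + 1); positivity
  have hc20 : 0 ≤ c2 := by have := hL k₂; have := hpos (m + k₂); positivity
  have hc30 : 0 ≤ c3 := by have := hL k₃; have := hpos (m + k₃); positivity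
  have hx1 : c1 ≤ s := le_trans (by simpa using hx1') hs
  have hpair1 : c1 + (k₂ : ℝ) * c2 ≤ σ₁ := le_trans (by simpa using hpair1') hσ1
  have hpair2 : (k₂ : ℝ) * c2 + (k₃ : ℝ) * c3 ≤ σ₂ := hpair2'.trans hσ2
  have hx2s : (k₂ : ℝ) * c2 ≤ s := hx2.trans hs
  have hx3s : (k₃ : ℝ) * c3 ≤ s := hx3.trans hs
  have hem := he0 m
  -- the joint polytope: Φ ≥ 0 and R₂ ≥ 0 at the actual loads
  obtain ⟨hΦ, hR2⟩ := joint_polytope_nonneg_guarded (B := Bc) (C := Cc) hs0 hs1 hc10 hx1 (mul_nonneg (Nat.cast_nonneg _) hc20) hx2s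
    (mul_nonneg (Nat.cast_nonneg _) hc30) hx3s hpair1 hpair2 hE0 hE1 hC0 hCB hb1 hρ1 c1ρ cert1 hρ2 c2ρ cert2a cert2b hρ3a hρ3b c3ρ cert3 ha2
    hρ4a hρ4b c4ρ cert4a cert4b
  -- unit conversions between loads and lag-zero coefficients (the parameters are upper bounds of the actual `4∕k₂, 4∕k₃, 2(k₂+1)∕k₃`)
  have e1 : 4 * c1 * c2 ≤ Bc * c1 * ((k₂ : ℝ) * c2) := by
    have e : 4 / (k₂ : ℝ) * c1 * ((k₂ : ℝ) * c2) = 4 * c1 * c2 := by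
      rw [div_mul_eq_mul_div, div_mul_eq_mul_div, div_eq_iff hk2ne]; ring
    have := mul_le_mul_of_nonneg_right hBc (mul_nonneg hc10 (mul_nonneg (Nat.cast_nonneg k₂) hc20))
    linarith [e, this]
  have e2 : 4 * c1 * c3 ≤ Cc * c1 * ((k₃ : ℝ) * c3) := by
    have e : 4 / (k₃ : ℝ) * c1 * ((k₃ : ℝ) * c3) = 4 * c1 * c3 := by
      rw [div_mul_eq_mul_div, div_mul_eq_mul_div, div_eq_iff hk3ne]; ring
    have := mul_le_mul_of_nonneg_right hCc (mul_nonneg hc10 (mul_nonneg (Nat.cast_nonneg k₃) hc30))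
    linarith [e, this]
  have e3 : 2 * ((k₂ : ℝ) * c2) * ((k₂ : ℝ) + 1) * c3 ≤ E * ((k₂ : ℝ) * c2) * ((k₃ : ℝ) * c3) := by
    have e : 2 * ((k₂ : ℝ) + 1) / k₃ * ((k₂ : ℝ) * c2) * ((k₃ : ℝ) * c3) = 2 * ((k₂ : ℝ) * c2) * ((k₂ : ℝ) + 1) * c3 := by
      rw [div_mul_eq_mul_div, div_mul_eq_mul_div, div_eq_iff hk3ne]; ring
    have := mul_le_mul_of_nonneg_right hE (mul_nonneg (mul_nonneg (Nat.cast_nonneg k₂) hc20) (mul_nonneg (Nat.cast_nonneg k₃) hc30))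
    linarith [e, this]
  -- STEP 1 (old residual): e − O ≥ (1 − x₃)e ≥ 0
  have hOle : ∑ l ∈ range K, KL k₃ m l * ε (m + 1 + l) ≤ (k₃ : ℝ) * c3 * e m := hreadle hk3K
  have hres1 : (1 - (k₃ : ℝ) * c3) * e m ≤ e m - ∑ l ∈ range K, KL k₃ m l * ε (m + 1 + l) := by linarith only [hOle]
  have hx3le1 : 0 ≤ 1 - (k₃ : ℝ) * c3 := by linarith
  have hres1' : 0 ≤ e m - ∑ l ∈ range K, KL k₃ m l * ε (m + 1 + l) := le_trans (mul_nonneg hx3le1 hem) hres1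
  -- STEP 2 (middle against old, actual loads)
  have hW2 : ∑ l ∈ range K, KL k₂ m l ≤ (k₂ : ℝ) * c2 := row_mass_le hL hh hg hKL hk2K m
  have hstep2 := residual_step_moment (i := k₂) (Kw := K) (m := m) (sy := (k₂ : ℝ) * c2) (V := 4 * c3)
    (M₁ := c2 * ((k₂ : ℝ) * ((k₂ : ℝ) + 1) / 2))
    (wy := fun l => KL k₂ m l) (O := fun p => ∑ l ∈ range K, KL k₃ p l * ε (p + 1 + l)) (e := e) (ε := ε)
    (fun l => (kernel_entry_le hL hh hg hKL k₂ m l).1) (fun l hl => by rw [hKL, if_neg (by omega)])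
    hW2 (row_moment_le hL hh hg hKL hk2K m) (by positivity) he0 hea
    (fun q hq => by
      have := hrec3 q
      have h1 := hread0 1 q hq.le
      have h2 := hread0 k₂ q hq.le
      linarith only [this, h1, h2])
    hres1'
    (fun d hd1 hdj => by
      have hdk : d ≤ k₃ := by omega
      have hv' := old_read_variation hmono hL hb hlo hdom hh hf hL0 hg hgF hKL hk hk3K hd1 hdk he0 hea IH
      rw [← hc3_def] at hv'
      linarith only [hv'])
  have hR2' : ((1 - (k₂ : ℝ) * c2) * (1 - (k₃ : ℝ) * c3) - E * ((k₂ : ℝ) * c2) * ((k₃ : ℝ) * c3)) * e m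
      ≤ e m - (∑ l ∈ range K, KL k₂ m l * ε (m + 1 + l) + ∑ l ∈ range K, KL k₃ m l * ε (m + 1 + l)) := by
    have hx2le1 : 0 ≤ 1 - (k₂ : ℝ) * c2 := by linarith
    have h1 := mul_le_mul_of_nonneg_left hres1 hx2le1
    have e4 : c2 * ((k₂ : ℝ) * ((k₂ : ℝ) + 1) / 2) * (4 * c3) * e m = 2 * ((k₂ : ℝ) * c2) * ((k₂ : ℝ) + 1) * c3 * e m := by ring
    have e3m := mul_le_mul_of_nonneg_right e3 hem
    linarith only [hstep2, h1, e4, e3m]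
  have hres2' : 0 ≤ e m - (∑ l ∈ range K, KL k₂ m l * ε (m + 1 + l) + ∑ l ∈ range K, KL k₃ m l * ε (m + 1 + l)) :=
    le_trans (mul_nonneg hR2 hem) hR2'
  -- STEP 3 (young against both, actual load x₁ = c₁, first moment c₁)
  have hW1 : ∑ l ∈ range K, KL 1 m l ≤ c1 :=
    (row_mass_le hL hh hg hKL h1K m).trans (le_of_eq (by rw [hc1_def]; simp))
  have hM1 : ∑ l ∈ range K, KL 1 m l * ((l : ℝ) + 1) ≤ c1 :=
    (row_moment_le hL hh hg hKL h1K m).trans (le_of_eq (by rw [hc1_def]; norm_num))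
  have hstep3 := residual_step_moment (i := 1) (Kw := K) (m := m) (sy := c1) (V := 4 * (c2 + c3)) (M₁ := c1)
    (wy := fun l => KL 1 m l)
    (O := fun p => ∑ l ∈ range K, KL k₂ p l * ε (p + 1 + l) + ∑ l ∈ range K, KL k₃ p l * ε (p + 1 + l)) (e := e) (ε := ε)
    (fun l => (kernel_entry_le hL hh hg hKL 1 m l).1) (fun l hl => by rw [hKL, if_neg (by omega)])
    hW1 hM1 (by positivity) he0 hea
    (fun q hq => by
      have := hrec3 q
      have h1 := hread0 1 q hq.le
      linarith only [this, h1])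
    hres2'
    (fun d hd1 hdi => by
      have hdj : d ≤ k₂ := by omega
      have hdk : d ≤ k₃ := by omega
      have hvj := old_read_variation hmono hL hb hlo hdom hh hf hL0 hg hgF hKL hj hk2K hd1 hdj he0 hea IH
      have hvk := old_read_variation hmono hL hb hlo hdom hh hf hL0 hg hgF hKL hk hk3K hd1 hdk he0 hea IH
      rw [← hc2_def] at hvj
      rw [← hc3_def] at hvk
      linarith only [hvj, hvk])
  -- assemble: ε ≥ (1−x₁)·R₂·e − 4c₁(c₂+c₃)e = Φ·e ≥ 0
  have hεm : ε m = e m - ∑ l ∈ range K, KL 1 m l * ε (m + 1 + l)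
      - (∑ l ∈ range K, KL k₂ m l * ε (m + 1 + l) + ∑ l ∈ range K, KL k₃ m l * ε (m + 1 + l)) := hrec3 m
  refine ⟨?_, ?_⟩
  · have hx1le1 : 0 ≤ 1 - c1 := by linarith
    have h1 := mul_le_mul_of_nonneg_left hR2' hx1le1
    have e1m := mul_le_mul_of_nonneg_right e1 hem
    have e2m := mul_le_mul_of_nonneg_right e2 hem
    have hge : ((1 - c1) * ((1 - (k₂ : ℝ) * c2) * (1 - (k₃ : ℝ) * c3) - E * ((k₂ : ℝ) * c2) * ((k₃ : ℝ) * c3))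
          - Bc * c1 * ((k₂ : ℝ) * c2) - Cc * c1 * ((k₃ : ℝ) * c3)) * e m
        ≤ e m - ∑ l ∈ range K, KL 1 m l * ε (m + 1 + l)
          - (∑ l ∈ range K, KL k₂ m l * ε (m + 1 + l) + ∑ l ∈ range K, KL k₃ m l * ε (m + 1 + l)) := by
      linarith only [hstep3, h1, e1m, e2m]
    rw [hεm]
    exact le_trans (mul_nonneg hΦ hem) hge
  · rw [hεm]
    linarith only [hread0 1 m le_rfl, hread0 k₂ m le_rfl, hread0 k₃ m le_rfl]

end Summit.QuantumFields.BalabanUV.Beta.EriceRemainderEnclosureHistoryAutonomyComparisonAgeCompositionNestedTwoPairs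

end
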